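/- Copyright: the b2b-balaban cell (near-miss cell 7), T⁴-continuum fan-out, lineage t4-ne7b-p1 (node U5c COUNT
member).  Released under the licence of the surrounding project. -/
import Summits.QuantumFields.BalabanUV.T4Continuum.Support.HistoryGenealogyExtractionTiming
import Summits.QuantumFields.BalabanUV.T4Continuum.Support.HistoryGenealogyExtractionLedger

/-!
# Genealogy extraction with PER-PART RENEWALS (H3-(ID), combinatorial half, v2 of row S13's extraction — repair
R-40-b of the located model finding F-ne7bp1g40-2): a line renewed by the 𝐑-operation at level `j` keeps its renewal
event even when it is MERGED at level `j + 1` (owner module of row NE7b, lineage `t4-ne7b-p1` gen 40, ruling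
R-OWNER-40-3; re-open object (α), `SCOPE-alpha.md` v2.2 §5 row M3a — PRE-POSITIONING ONLY)

Summits-side support leaf of the T⁴-continuum cell (rung (B)+1 on a FINITE torus only; NOT infinite volume, NOT the
mass gap, NOT the Clay statement; NOT a proof of the spine estimate NE7b, which is the cell's OWN estimate, NOT PRINTED
and NOT PROVED).  [folklore] finite combinatorics over row S13's `HistoryGenealogyExtraction` (`ComponentHistory`,
`WF`, `joinTail`, `births`, `parts`, `news`, p244684; `…Timing` p244827; `…Ledger` p244828 — `evProd`, `continued`,
`died`, `prod_comp_eq_continued_mul_died`), which it imports and does not modify; nothing printed is asserted, no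
`def … : Prop` fact of Bałaban's, no cite-tagged hypothesis, zero `sorry`.  B16 = [Balaban1989LargeFieldII] pp. 383–387
and B15 = [Balaban1989LargeFieldI] p. 177 are manuscripts UNDER AUDIT; locators only (C-B16-6).

WHY (the located finding F-ne7bp1g40-2, MODEL side).  Row S13's extraction `pgen` books a RENEWAL only for a
component continued ALONE (`ren = (news = []) && fieldIn`, a flag of the level-`(j+1)` component).  Print renews by
the 𝐑-operation acting on the `j`-th density: every component `Z₀` of `Z_j` that «satisfies the conditions (i), (ii)»
at scale `j` and had «a new large field … introduced in the preparatory operations» gets «the new factor exp(−p₀(g_j))»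
and a fresh clock «K = R_{j+1} for Z» (B16 p. 385 bottom – p. 386 l. 3; B15 p. 177) — a property of the PART `Z₀`,
decided before the large-field regions of level `j + 1` exist (they carry `g_{j+1}` in (1.85)); the renewed image
`S(Z₀)` may then still be MERGED at level `j + 1` (p. 386 second case: vertex `X = S(Z₀)` of the graph `G` with its
renewed `κ_{j+1}(X)`).  The pedigree of such a component is `join (renew (pgen j p) j) … (j+1)`, which `pgen` never
produces; without the renewal event the merged partner violates print-exact pendency at the join (it WAS ready at
scale `j`; `HistoryRealisePrint.RealisesP`, F-ne7bp1g40-1), so the (ID) junction cannot be typed over `pgen` for terms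
containing such histories.  REPAIR: the renewal flag is PER PART — `rnw j p` for a component `p` of level `j` renewed by
𝐑^{(j)} — and every old part enters the constituents of its level-`(j+1)` component as `renew (· ) j` or bare
accordingly; the lone-renewal case of row S13 is the special case of a one-element constituent list.  The data type
`ComponentHistory` is UNCHANGED (its field `fieldIn` is simply not read by this extraction); `WF` is reused verbatim.

WHAT IS DEFINED AND PROVED.  §1 `wrapR rnw rec j p` (the part's genealogy, renewed at `j` iff flagged), `assembleR`
(print's case split on the constituent list: one constituent ↦ itself, at least two ↦ the join chain `joinTail`),
`constituentsR`, **`pgenR H rnw : ℕ → γ → PGen γ`**; one-step equations `pgenR_succ_lone`, `pgenR_succ_renew`,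
`pgenR_succ_birth`, `pgenR_zero_eq`, `pgenR_succ_eq`; list laws `mem_constituentsR_iff`, `prod_map_constituentsR`,
`sum_map_constituentsR`, `constituentsR_ne_nil`.  §2 TIMING: `lastStep_wrapR_le`, `lastStep_assembleR_le`,
`adm_assembleR`, `rootStep_assembleR_le`, **`lastStep_pgenR_le`**, `rootStep_pgenR_le`, **`adm_pgenR`** (print's discipline
`Adm K` for every extracted genealogy, `j ≤ K`).  §3 EVENT PRODUCTS: `evProd_wrapR`, `evProd_assembleR`,
**`evProd_pgenR_succ`** (one-step multiplicativity: parts' products × renewal factors `fR j` of the RENEWED PARTS × birth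
weights of the new regions), `evProd_pgenR_zero`, `regions_pgenR_succ`∕`_zero`, and **`forest_evProd_eqR`** (THE FOREST
IDENTITY: Π over the genealogies live at `K` and dead before = Π_{j ≤ K} Π_{c ∈ comp j} (renewal factors of its renewed
parts · birth weights of its new regions)).  §4 DECIDED SANITY on row S13's toy bookkeeping with the part-flag «region
`1` renewed at level `0`»: the same expected genealogy; and the NEW case — a renewed line merged at the next level —
extracted as `join (renew …) (birth …)`.  Sibling `…ExtractionRLedger`: event products, region counts, the forest identity for
`pgenR`.

HONEST.  Proves nothing of Bałaban's; BY-NAME EFFECT ON THE WALL: NONE (pre-positioning for (α)); NE7b NOT proved;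
spine 0∕9.  HONEST DEPENDENCY (cell): continuum YM on T⁴ ⇐ BetaPertH ∧ nine spine estimates (0/9 proved); BetaPertH ⇐
(D1) ∧ (D4) ∧ CAP+tail; G-an2-4 gates asym, D1 and NE2/3/4.  This file changes none of it. -/

open Finset
open Literature.MathematicalPhysics.QuantumFieldTheory.Balaban1983to89

namespace Summit.QuantumFields.BalabanUV.T4Continuum.HistoryGenealogyExtraction

open HistoryAdmissible HistoryAdmissible.PGen

/-! ## §1 The extraction with per-part renewals -/

section Defs

variable {γ : Type*}

/-- the genealogy with which an old part `p` of level `j` enters its level-`(j+1)` component: RENEWED at `j` (event at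
`j + 1`) iff the part is flagged, else unchanged [folklore] -/
def wrapR (rnw : ℕ → γ → Bool) (rec : γ → PGen γ) (j : ℕ) (p : γ) : PGen γ :=
  if rnw j p = true then PGen.renew (rec p) j else rec p

/-- `wrapR` of a flagged part [folklore] -/
@[simp] theorem wrapR_of_true {rnw : ℕ → γ → Bool} (rec : γ → PGen γ) {j : ℕ} {p : γ} (h : rnw j p = true) :
    wrapR rnw rec j p = PGen.renew (rec p) j := by simp [wrapR, h]

/-- `wrapR` of an unflagged part [folklore] -/
@[simp] theorem wrapR_of_false {rnw : ℕ → γ → Bool} (rec : γ → PGen γ) {j : ℕ} {p : γ} (h : rnw j p = false) :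
    wrapR rnw rec j p = rec p := by simp [wrapR, h]

/-- **PRINT'S CASE SPLIT** on the constituents of a component of level `s` (renewals already inside the constituents):
none ↦ a junk birth (excluded by `WF`); one ↦ itself; at least two ↦ the join chain at `s`. [folklore] -/
def assembleR (c : γ) (s : ℕ) : List (PGen γ) → PGen γ
  | [] => PGen.birth s 0 c
  | [T] => T
  | T :: U :: L => joinTail T (U :: L) s

/-- `assembleR` on a singleton [folklore] -/
@[simp] theorem assembleR_singleton (c : γ) (s : ℕ) (T : PGen γ) : assembleR c s [T] = T := rfl

/-- `assembleR` on at least two constituents [folklore] -/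
@[simp] theorem assembleR_cons_cons (c : γ) (s : ℕ) (T U : PGen γ) (L : List (PGen γ)) :
    assembleR c s (T :: U :: L) = joinTail T (U :: L) s := rfl

end Defs

namespace ComponentHistory

variable {γ : Type*} (H : ComponentHistory γ) (rnw : ℕ → γ → Bool)

/-- the constituents of a component `c` of level `j + 1`, renewals inside: the (wrapped) genealogy of an old part, the
birth of a new region, in the listed leaf-first order [folklore] -/
def constituentsR (rec : γ → PGen γ) (j : ℕ) (c : γ) : List (PGen γ) :=
  (H.constit (j + 1) c).map (Sum.elim (wrapR rnw rec j) fun n => PGen.birth (j + 1) (H.cls n) n)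

/-- **THE EXTRACTION WITH PER-PART RENEWALS**: level `0` assembles births; level `j + 1` assembles the wrapped part
genealogies and the births. [folklore] -/
def pgenR : ℕ → γ → PGen γ
  | 0, c => assembleR c 0 (H.births 0 c)
  | j + 1, c => assembleR c (j + 1) (H.constituentsR rnw (pgenR j) j c)

/-- the defining equation at level `0` [folklore] -/
theorem pgenR_zero_eq (c : γ) : H.pgenR rnw 0 c = assembleR c 0 (H.births 0 c) := rfl

/-- the defining equation at a successor level [folklore] -/
theorem pgenR_succ_eq (j : ℕ) (c : γ) :
    H.pgenR rnw (j + 1) c = assembleR c (j + 1) (H.constituentsR rnw (H.pgenR rnw j) j c) := rfl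

/-- **LONE UNFLAGGED PART** (no event, (1.83)): the part's genealogy unchanged [folklore] -/
theorem pgenR_succ_lone (j : ℕ) (c p : γ) (hp : H.constit (j + 1) c = [Sum.inl p]) (hr : rnw j p = false) :
    H.pgenR rnw (j + 1) c = H.pgenR rnw j p := by
  rw [pgenR_succ_eq]; simp [constituentsR, hp, hr]

/-- **LONE RENEWED PART** (p. 386 ll. 1–3): `renew (pgenR j p) j` [folklore] -/
theorem pgenR_succ_renew (j : ℕ) (c p : γ) (hp : H.constit (j + 1) c = [Sum.inl p]) (hr : rnw j p = true) :
    H.pgenR rnw (j + 1) c = PGen.renew (H.pgenR rnw j p) j := by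
  rw [pgenR_succ_eq]; simp [constituentsR, hp, hr]

/-- **LONE BIRTH** [folklore] -/
theorem pgenR_succ_birth (j : ℕ) (c n : γ) (hn : H.constit (j + 1) c = [Sum.inr n]) :
    H.pgenR rnw (j + 1) c = PGen.birth (j + 1) (H.cls n) n := by
  rw [pgenR_succ_eq]; simp [constituentsR, hn]

/-- birth at level `0` of a lone new region [folklore] -/
theorem pgenR_zero_birth (c n : γ) (hn : H.constit 0 c = [Sum.inr n]) :
    H.pgenR rnw 0 c = PGen.birth 0 (H.cls n) n := by
  rw [pgenR_zero_eq]; simp [births, news, hn]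

/-- length of the constituents list [folklore] -/
theorem length_constituentsR (rec : γ → PGen γ) (j : ℕ) (c : γ) :
    (H.constituentsR rnw rec j c).length = (H.parts (j + 1) c).length + (H.news (j + 1) c).length := by
  simp only [constituentsR, List.length_map, parts, news, length_lefts_add_length_rights]

/-- MEMBERSHIP in the constituents list: the wrapped genealogy of a part, or a birth [folklore] -/
theorem mem_constituentsR_iff (rec : γ → PGen γ) (j : ℕ) (c : γ) (U : PGen γ) :
    U ∈ H.constituentsR rnw rec j c ↔ (∃ p ∈ H.parts (j + 1) c, wrapR rnw rec j p = U) ∨ U ∈ H.births (j + 1) c := by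
  simp only [constituentsR, births, parts, news, List.mem_map, mem_lefts_iff, mem_rights_iff]
  constructor
  · rintro ⟨x, hx, rfl⟩
    cases x with
    | inl p => exact Or.inl ⟨p, hx, rfl⟩
    | inr n => exact Or.inr ⟨n, hx, rfl⟩
  · rintro (⟨p, hp, rfl⟩ | ⟨n, hn, rfl⟩)
    · exact ⟨Sum.inl p, hp, rfl⟩
    · exact ⟨Sum.inr n, hn, rfl⟩

/-- a product over the constituents splits: wrapped parts' values times births' values [folklore] -/
theorem prod_map_constituentsR {M : Type*} [CommMonoid M] (f : PGen γ → M) (rec : γ → PGen γ) (j : ℕ) (c : γ) :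
    ((H.constituentsR rnw rec j c).map f).prod =
      ((H.parts (j + 1) c).map fun p => f (wrapR rnw rec j p)).prod *
        ((H.news (j + 1) c).map fun n => f (PGen.birth (j + 1) (H.cls n) n)).prod := by
  simp only [constituentsR, parts, news, List.map_map]
  rw [show f ∘ Sum.elim (wrapR rnw rec j) (fun n => PGen.birth (j + 1) (H.cls n) n) =
      Sum.elim (fun p => f (wrapR rnw rec j p)) (fun n => f (PGen.birth (j + 1) (H.cls n) n)) from
    funext fun x => by cases x <;> rfl]
  exact prod_map_sum_elim _ _ _

/-- a sum over the constituents splits likewise [folklore] -/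
theorem sum_map_constituentsR {M : Type*} [AddCommMonoid M] (f : PGen γ → M) (rec : γ → PGen γ) (j : ℕ) (c : γ) :
    ((H.constituentsR rnw rec j c).map f).sum =
      ((H.parts (j + 1) c).map fun p => f (wrapR rnw rec j p)).sum +
        ((H.news (j + 1) c).map fun n => f (PGen.birth (j + 1) (H.cls n) n)).sum := by
  simp only [constituentsR, parts, news, List.map_map]
  rw [show f ∘ Sum.elim (wrapR rnw rec j) (fun n => PGen.birth (j + 1) (H.cls n) n) =
      Sum.elim (fun p => f (wrapR rnw rec j p)) (fun n => f (PGen.birth (j + 1) (H.cls n) n)) from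
    funext fun x => by cases x <;> rfl]
  exact sum_map_sum_elim _ _ _

variable [DecidableEq γ]

/-- under `WF` the constituents list of a component is nonempty [folklore] -/
theorem constituentsR_ne_nil (hW : H.WF) (rec : γ → PGen γ) {j : ℕ} {c : γ} (hc : c ∈ H.comp (j + 1)) :
    H.constituentsR rnw rec j c ≠ [] := by
  simpa [constituentsR] using hW.nonempty (j + 1) c hc

end ComponentHistory

/-! ## §2 Timing -/

section Timing

variable {γ : Type*}

/-- the wrapped genealogy of a part has last step `≤ j + 1` if the part's is `≤ j` [folklore] -/
theorem lastStep_wrapR_le (rnw : ℕ → γ → Bool) (rec : γ → PGen γ) {j : ℕ} {p : γ} (h : (rec p).lastStep ≤ j) :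
    (wrapR rnw rec j p).lastStep ≤ j + 1 := by
  unfold wrapR; split_ifs
  · simp [lastStep]
  · exact h.trans (Nat.le_succ j)

/-- the wrapped genealogy has the part's root step [folklore] -/
@[simp] theorem rootStep_wrapR (rnw : ℕ → γ → Bool) (rec : γ → PGen γ) (j : ℕ) (p : γ) :
    (wrapR rnw rec j p).rootStep = (rec p).rootStep := by
  unfold wrapR; split_ifs <;> simp [rootStep]

/-- the wrapped genealogy is `Adm K` for `j + 1 ≤ K` if the part's is, with last step `≤ j` [folklore] -/
theorem adm_wrapR (rnw : ℕ → γ → Bool) (rec : γ → PGen γ) {K j : ℕ} (hK : j + 1 ≤ K) {p : γ} (hA : (rec p).Adm K)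
    (hl : (rec p).lastStep ≤ j) : (wrapR rnw rec j p).Adm K := by
  unfold wrapR; split_ifs
  · exact ⟨hA, hl, hK⟩
  · exact hA

/-- the last step of an `assembleR`d genealogy at step `s` is at most `s` if every constituent's is [folklore] -/
theorem lastStep_assembleR_le (c : γ) {s : ℕ} :
    ∀ L : List (PGen γ), (∀ U ∈ L, U.lastStep ≤ s) → (assembleR c s L).lastStep ≤ s
  | [], _ => by simp [assembleR, lastStep]
  | [T], hL => by simpa [assembleR] using hL T (by simp)
  | T :: U :: L, _ => by simp [assembleR, lastStep]

/-- `Adm K` of an `assembleR`d genealogy at step `s ≤ K` from `Adm K` and `lastStep ≤ s` of all constituents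
[folklore] -/
theorem adm_assembleR (c : γ) {K s : ℕ} (hs : s ≤ K) :
    ∀ L : List (PGen γ), (∀ U ∈ L, U.Adm K ∧ U.lastStep ≤ s) → (assembleR c s L).Adm K
  | [], _ => by simpa [assembleR, Adm] using hs
  | [T], hL => by simpa [assembleR] using (hL T (by simp)).1
  | T :: U :: L, hL => by
      have hT := hL T (by simp)
      simp only [assembleR_cons_cons]
      exact adm_joinTail hs T (U :: L) hT.1 hT.2 (fun V hV => hL V (by simp [hV]))

/-- the root step of an `assembleR`d genealogy is at most `s` if every constituent's is [folklore] -/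
theorem rootStep_assembleR_le (c : γ) (s : ℕ) :
    ∀ L : List (PGen γ), (∀ U ∈ L, U.rootStep ≤ s) → (assembleR c s L).rootStep ≤ s
  | [], _ => by simp [assembleR, rootStep]
  | [T], hL => by simpa [assembleR] using hL T (by simp)
  | T :: U :: L, hL => by
      have hT := hL T (by simp)
      simp only [assembleR_cons_cons]
      exact (rootStep_joinTail_le T (U :: L) s).trans hT

end Timing

namespace ComponentHistory

variable {γ : Type*} (H : ComponentHistory γ) (rnw : ℕ → γ → Bool)

/-- **`lastStep (pgenR H rnw j c) ≤ j`.** [folklore] -/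
theorem lastStep_pgenR_le : ∀ (j : ℕ) (c : γ), (H.pgenR rnw j c).lastStep ≤ j
  | 0, c => by
      rw [pgenR_zero_eq]
      exact lastStep_assembleR_le c _ fun U hU => ((H.births_spec (K := 0) 0 c U hU).1).le
  | j + 1, c => by
      rw [pgenR_succ_eq]
      refine lastStep_assembleR_le c _ fun U hU => ?_
      rcases (H.mem_constituentsR_iff rnw _ j c U).1 hU with ⟨p, -, rfl⟩ | hb
      · exact lastStep_wrapR_le rnw _ (lastStep_pgenR_le j p)
      · exact ((H.births_spec (K := 0) (j + 1) c U hb).1).le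

/-- **`rootStep (pgenR H rnw j c) ≤ j`.** [folklore] -/
theorem rootStep_pgenR_le : ∀ (j : ℕ) (c : γ), (H.pgenR rnw j c).rootStep ≤ j
  | 0, c => by
      rw [pgenR_zero_eq]
      exact rootStep_assembleR_le c 0 _ fun U hU => ((H.births_spec (K := 0) 0 c U hU).2.1).le
  | j + 1, c => by
      rw [pgenR_succ_eq]
      refine rootStep_assembleR_le c (j + 1) _ fun U hU => ?_
      rcases (H.mem_constituentsR_iff rnw _ j c U).1 hU with ⟨p, -, rfl⟩ | hb
      · rw [rootStep_wrapR]; exact (rootStep_pgenR_le j p).trans (Nat.le_succ j)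
      · exact ((H.births_spec (K := 0) (j + 1) c U hb).2.1).le

/-- **PRINT'S TIMING DISCIPLINE HOLDS FOR EVERY EXTRACTED GENEALOGY**: `j ≤ K → (pgenR H rnw j c).Adm K`. [folklore] -/
theorem adm_pgenR {K : ℕ} : ∀ (j : ℕ) (c : γ), j ≤ K → (H.pgenR rnw j c).Adm K
  | 0, c, hK => by
      rw [pgenR_zero_eq]
      refine adm_assembleR c hK _ fun U hU => ?_
      have hs := H.births_spec (K := K) 0 c U hU
      exact ⟨hs.2.2 hK, hs.1.le⟩
  | j + 1, c, hK => by
      rw [pgenR_succ_eq]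
      refine adm_assembleR c hK _ fun U hU => ?_
      rcases (H.mem_constituentsR_iff rnw _ j c U).1 hU with ⟨p, -, rfl⟩ | hb
      · exact ⟨adm_wrapR rnw _ hK (adm_pgenR j p (by omega)) (H.lastStep_pgenR_le rnw j p),
          lastStep_wrapR_le rnw _ (H.lastStep_pgenR_le rnw j p)⟩
      · have hs := H.births_spec (K := K) (j + 1) c U hb
        exact ⟨hs.2.2 hK, hs.1.le⟩

end ComponentHistory

/-! ## §3 Sanity, decided (row S13's toy, renewal flagged on the PART) -/

namespace SanityR

open ComponentHistory

/-- the part flag of the toy: region `1` is renewed by the level-`0` 𝐑-operation [folklore] -/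
def rnwToy : ℕ → ℕ → Bool := fun j p => decide (j = 0 ∧ p = 1)

/-- the per-part extraction computes the same genealogy as row S13's on its toy [folklore] -/
example : Sanity.toy.pgenR rnwToy 2 5 = Sanity.expected := by decide

/-- THE NEW CASE: a line renewed at level `0` and MERGED at level `1` with a newborn region — bookkeeping over labels
`ℕ`: level 0 component `1` (region `1`, class `1`), renewed; level 1 component `5` with constituents `[inl 1, inr 7]`
[folklore] -/
def toyRM : ComponentHistory ℕ where
  comp j := if j = 0 then {1} else if j = 1 then {5} else ∅
  newReg j := if j = 0 then {1} else if j = 1 then {7} else ∅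
  cls n := if n = 1 then 1 else 0
  constit j c := if j = 0 ∧ c = 1 then [Sum.inr 1] else if j = 1 ∧ c = 5 then [Sum.inl 1, Sum.inr 7] else []
  fieldIn _ _ := false

/-- it extracts `join (renew (birth 0 1 1) 0) (birth 1 0 7) 1` — the pedigree row S13's `pgen` cannot produce
[folklore] -/
example : toyRM.pgenR rnwToy 1 5 = PGen.join (PGen.renew (PGen.birth 0 1 1) 0) (PGen.birth 1 0 7) 1 := by decide

/-- whereas row S13's extraction of the same data drops the renewal [folklore] -/
example : toyRM.pgen 1 5 = PGen.join (PGen.birth 0 1 1) (PGen.birth 1 0 7) 1 := by decide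

end SanityR

end Summit.QuantumFields.BalabanUV.T4Continuum.HistoryGenealogyExtraction
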